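import Summits.FinalStateConjecture.FinalStateConjecture.Theorems.UniformPhotonSphereChannels.Negative.InitialSlice

/-!
# Crux `UniformPhotonSphereChannels` (K1), negative side — ray points of the Rindler chart and
# the initial energies of the horizon-frame solution

Support file of the standing disprover of item stmt-FinalStateConjecture-10045.

* `ray_point`: on the ray `T = βX` of the Rindler chart (`α = log(κ·)/κ`, `α′ = 1/(κ·)` on
  `(A₀, ∞)`, `A₀ < X(1−β)`) the tortoise time is the constant `t₁ = log((1+β)/(1−β))/2κ`, the
  tortoise position is `ξ(X) = (log(κX(1+β)) + log(κX(1−β)))/2κ`, and the conformal factor is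
  `α′(X+βX)α′(X−βX) = 1/(κ²X²(1−β²))`;
* `initial_energy_eq`, `initial_commutedEnergy_eq`: the energy and the commuted energy of the
  initial slice of the conformal composite with even data `g` over any interval are
  `∫ (G′² + V(α)α′²G²)` and `∫ G″² + ∫ V(α)α′²G′²`, `G = g ∘ α` — data only. [folklore]
-/

namespace Summit.FinalStateConjecture.FinalStateConjecture.Theorems

open Set Filter Topology MeasureTheory intervalIntegral

noncomputable section

namespace WaveDefect

open WaveEnergy

/-- **Ray points of the Rindler chart.** -/
theorem ray_point {α : ℝ → ℝ} {κ A₀ β X : ℝ} (hκ : 0 < κ) (hβ0 : 0 ≤ β) (hβ1 : β < 1)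
    (hαlog : ∀ a, A₀ < a → α a = Real.log (κ * a) / κ)
    (hα' : ∀ a, A₀ < a → deriv α a = 1 / (κ * a)) (hXpos : 0 < X) (hX : A₀ < X * (1 - β)) :
    (α (X + β * X) - α (X - β * X)) / 2 = Real.log ((1 + β) / (1 - β)) / (2 * κ) ∧
    (α (X + β * X) + α (X - β * X)) / 2
      = (Real.log (κ * (X * (1 + β))) + Real.log (κ * (X * (1 - β)))) / (2 * κ) ∧
    deriv α (X + β * X) * deriv α (X - β * X) = 1 / (κ ^ 2 * X ^ 2 * (1 - β ^ 2)) := by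
  have h1b : 0 < 1 - β := by linarith
  have h1b' : 0 < 1 + β := by linarith
  have hB : A₀ < X * (1 - β) := hX
  have hA : A₀ < X * (1 + β) :=
    lt_of_lt_of_le hB (mul_le_mul_of_nonneg_left (by linarith) hXpos.le)
  have hApB : X + β * X = X * (1 + β) := by ring
  have hAmB : X - β * X = X * (1 - β) := by ring
  have hp1 : 0 < κ * (X * (1 + β)) := mul_pos hκ (mul_pos hXpos h1b')
  have hp2 : 0 < κ * (X * (1 - β)) := mul_pos hκ (mul_pos hXpos h1b)
  rw [hApB, hAmB]
  refine ⟨?_, ?_, ?_⟩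
  · rw [hαlog _ hA, hαlog _ hB]
    have hq : (1 + β) / (1 - β) = κ * (X * (1 + β)) / (κ * (X * (1 - β))) := by
      rw [div_eq_div_iff h1b.ne' hp2.ne']; ring
    rw [hq, Real.log_div hp1.ne' hp2.ne']
    ring
  · rw [hαlog _ hA, hαlog _ hB]
    ring
  · rw [hα' _ hA, hα' _ hB]
    have hne3 : κ ^ 2 * X ^ 2 * (1 - β ^ 2) ≠ 0 := by
      have hβ2 : 0 < 1 - β ^ 2 := by
        rw [show (1 : ℝ) - β ^ 2 = (1 - β) * (1 + β) by ring]; exact mul_pos h1b h1b'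
      exact mul_ne_zero (mul_ne_zero (pow_ne_zero 2 hκ.ne') (pow_ne_zero 2 hXpos.ne')) hβ2.ne'
    rw [div_mul_div_comm, one_mul, div_eq_div_iff (mul_ne_zero hp1.ne' hp2.ne') hne3]
    ring

variable {ψ : ℝ → ℝ → ℝ} {α V g : ℝ → ℝ} {u W : ℝ × ℝ → ℝ}

/-- `G = g ∘ α` is `C³` with the data, and its first two derivatives are continuous. -/
theorem contDiff_comp_data (hψ : ContDiff ℝ 3 (Function.uncurry ψ)) (hα : ContDiff ℝ 3 α)
    (h0 : ∀ x, ψ 0 x = g x) :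
    ContDiff ℝ 3 (fun y => g (α y)) ∧ Continuous (deriv (fun y => g (α y))) ∧
      Continuous (deriv (deriv (fun y => g (α y)))) := by
  have hG : ContDiff ℝ 3 (fun y => g (α y)) := (contDiff_data hψ h0).comp hα
  have h21 : ContDiff ℝ (2 + 1) (fun y => g (α y)) := by
    rwa [show ((2 : WithTop ℕ∞) + 1) = 3 by norm_num]
  have hG' : ContDiff ℝ 2 (deriv fun y => g (α y)) := (contDiff_succ_iff_deriv.mp h21).2.2
  have h11 : ContDiff ℝ (1 + 1) (deriv fun y => g (α y)) := by rwa [one_add_one_eq_two]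
  have hG'' : ContDiff ℝ 1 (deriv (deriv fun y => g (α y))) :=
    (contDiff_succ_iff_deriv.mp h11).2.2
  exact ⟨hG, hG'.continuous, hG''.continuous⟩

/-- **The energy of the initial slice is determined by the data**: over any interval,
`∫ e(0, ·) = ∫ (G′² + V(α)α′²G²)`, `G = g ∘ α`. -/
theorem initial_energy_eq (hψ : ContDiff ℝ 2 (Function.uncurry ψ)) (hα : ContDiff ℝ 2 α)
    (h0 : ∀ x, ψ 0 x = g x) (h1 : ∀ x, deriv (fun τ => ψ τ x) 0 = 0)
    (hu : u = fun z : ℝ × ℝ => ψ ((α (z.2 + z.1) - α (z.2 - z.1)) / 2)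
      ((α (z.2 + z.1) + α (z.2 - z.1)) / 2))
    (hW : W = fun z : ℝ × ℝ => V ((α (z.2 + z.1) + α (z.2 - z.1)) / 2)
      * deriv α (z.2 + z.1) * deriv α (z.2 - z.1))
    {e : ℝ × ℝ → ℝ}
    (he : ∀ z, e z = (fderiv ℝ u z (1, 0)) ^ 2 + (fderiv ℝ u z (0, 1)) ^ 2 + W z * u z ^ 2)
    (a b : ℝ) :
    ∫ X in a..b, e (0, X)
      = ∫ X in a..b, (deriv (fun y => g (α y)) X ^ 2 + V (α X) * deriv α X ^ 2 * g (α X) ^ 2) :=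
  intervalIntegral.integral_congr fun X _ => initial_energyDensity hψ hα h0 h1 hu hW he X

/-- **The commuted energy of the initial slice is determined by the data**: over any interval,
`∫ e₁(0, ·) = ∫ G″² + ∫ V(α)α′²G′²`, `G = g ∘ α` (`V` continuous). -/
theorem initial_commutedEnergy_eq (hψ : ContDiff ℝ 3 (Function.uncurry ψ)) (hα : ContDiff ℝ 3 α)
    (hVc : Continuous V)
    (h0 : ∀ x, ψ 0 x = g x) (h1 : ∀ x, deriv (fun τ => ψ τ x) 0 = 0)
    (hu : u = fun z : ℝ × ℝ => ψ ((α (z.2 + z.1) - α (z.2 - z.1)) / 2)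
      ((α (z.2 + z.1) + α (z.2 - z.1)) / 2))
    (hW : W = fun z : ℝ × ℝ => V ((α (z.2 + z.1) + α (z.2 - z.1)) / 2)
      * deriv α (z.2 + z.1) * deriv α (z.2 - z.1))
    {e₁ : ℝ × ℝ → ℝ}
    (he₁ : ∀ z, e₁ z = (fderiv ℝ (fun w => fderiv ℝ u w (0, 1)) z (1, 0)) ^ 2
      + (fderiv ℝ (fun w => fderiv ℝ u w (0, 1)) z (0, 1)) ^ 2
      + W z * (fderiv ℝ u z (0, 1)) ^ 2)
    (a b : ℝ) :
    ∫ X in a..b, e₁ (0, X)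
      = (∫ X in a..b, deriv (deriv (fun y => g (α y))) X ^ 2)
        + ∫ X in a..b, V (α X) * deriv α X ^ 2 * deriv (fun y => g (α y)) X ^ 2 := by
  obtain ⟨-, hG'c, hG''c⟩ := contDiff_comp_data hψ hα h0
  have hα'c : Continuous (deriv α) := hα.continuous_deriv (by norm_num)
  rw [intervalIntegral.integral_congr fun X _ => initial_commutedDensity hψ hα h0 h1 hu hW he₁ X]
  have hi1 : IntervalIntegrable (fun X => deriv (deriv (fun y => g (α y))) X ^ 2) volume a b :=
    (hG''c.pow 2).intervalIntegrable _ _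
  have hi2 : IntervalIntegrable
      (fun X => V (α X) * deriv α X ^ 2 * deriv (fun y => g (α y)) X ^ 2) volume a b :=
    ((((hVc.comp hα.continuous).mul (hα'c.pow 2))).mul (hG'c.pow 2)).intervalIntegrable _ _
  exact intervalIntegral.integral_add hi1 hi2

end WaveDefect

end

end Summit.FinalStateConjecture.FinalStateConjecture.Theorems
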